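import Summits.BirchSwinnertonDyer.Rank1Residual.Partition.Rows
import Summits.BirchSwinnertonDyer.Rank1Residual.X11b.Three.KolyvaginNonvanishing
import Literature.NumberTheory.EllipticCurves.GreenbergSelmer
import Literature.NumberTheory.EllipticCurves.PAdicLFunction
import Literature.NumberTheory.EllipticCurves.Wuthrich2014.IntegralPAdicLFunctionMultiplicative
import HarnessLib

/-!
# Route `ErratumRoadFive` (rung K2, `p ≥ 5`), crux 6 `NonSurjCorner` (item stmt-BirchSwinnertonDyer-19065):
# the objects a GLUED SPLIT posits — the three BRANCHES (Zₚᶜ, Jₚᶜ, TwinMu) as Theses-free `Prop` constants,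
# plus TwinMu's ANALYTIC form TwinMuAn (rung K6's `AnalyticMuZeroX9` shape read at `p ∥ N`)
# (cell `bsd-stepL`, seat `bsd-stepL-corner-p1` g6;
# planner g28 ruling (B) (c1)–(c2), STATUS 2026-08-27T01:23:07Z; `--supports stmt-BirchSwinnertonDyer-19065`)

This module imports NO Theses file (pattern of `ErratumRoadFiveRest3BranchesDefs.lean`, rest-p2): the route file
`Theses/ErratumRoadFive.lean` MAY import it, so the planner's `route edit --split NonSurjCorner --into …` can type the
children BY NAME as the constants below; the glue `nonSurjCorner_of_branches : NonSurjCornerKolyZ → NonSurjCornerKolyJ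
→ NonSurjCornerTwinMu → KatoTwinFactsFive → X11aLowerHalf → NonSurjCorner` lives in the sibling
`Theorems/ErratumRoadFiveNonSurjCornerBranches.lean` (it must import the route file to conclude the parent BY NAME,
precedent item 19284 `openInputIMCOfChildren_holds`).

THE CRUX (item 19065, text of the route file): for `(E,p) ∈ X11b` (`r_an = 1`, `p ∥ N` odd, `E[p]` irreducible)
with `ρ̄_{E,p}` NOT onto, `p ∈ {5,7}`, `p ∣ ord_p Δ_min` and no (ram) witness: the whole `p`-part
`Typed.MissingPPartAt W p`. The seat's g0–g5 kernel (Theorems/ErratumRoadFiveNonSurjCorner*.lean, all landed) puts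
the corner on the KOLYVAGIN road: modulo the fifteen PUBLISHED ∕ cited facts of the record, the six named facts of
the twin's rational Kato layer (Kato 2004 §12 / §17.13 at `p ∥ N`, Greenberg 1999 Thm. 1.5, Wuthrich 2014 Cor. 18)
and crux 19064 `X11aLowerHalf` at the leaf twins, `NonSurjCorner` follows from EXACTLY three open shapes
(`X11b.erratumRoadFive_nonSurjCorner_of_refinedKolyvagin_of_lowerX11a_of_katoFacts_of_twinMuZero`, p478491):

* **Zₚᶜ = `NonSurjCornerKolyZ`** — on every corner frame (classical Heegner field `K` with `|d_K| > 4` in which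
  `p` splits, Manin-good parametrisation `Dt`, `β`, `ι`) a Kolyvagin CERTIFICATE of level `≤ t + 1`,
  `t = ord_p ∏ c_ℓ(E/ℚ)`: `∃ M ≤ t, CertificateAt Dt β ι p M` (McCallum's `M_∞ ≤ t`; W. Zhang 2014 Thm. 1.1 proves
  `M_∞ = 0` under `ρ̄` onto and ♠ at good ordinary `p ∤ N` — here neither holds).
* **Jₚᶜ = `NonSurjCornerKolyJ`** — the Jetchev direction on the same frames: every derived Heegner point `P_n`
  over Kolyvagin primes of index `≥ s`, `s ≤ t`, is `p^s`-divisible (`M_∞ ≥ t`; Jetchev 2008 Conj. 1.3's shape,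
  printed only for `p ∤ N`).
* **TwinMu = `NonSurjCornerTwinMu`** — Greenberg's `μ = 0` (LNM 1716 Conj. 1.11) for the cyclotomic Selmer dual
  of the LEAF TWINS: the rank-0 sisters `Wd ∈ X11a` with `ρ̄` not onto, `p ∈ {5,7}`, `p ∣ ord_p Δ_min(Wd)` — the
  ONLY input of the twin's integral Kato divisibility not in print at a non-surjective irreducible image
  (Wuthrich 2014 Prop. 21 excludes exactly «primes for which the Galois representation on E[p] is neither
  surjective nor contained in a Borel subgroup»); rung K6's transfer object at a multiplicative prime.

* **TwinMuAn = `NonSurjCornerTwinMuAn`** — the ANALYTIC form of TwinMu, for the planner's choice under (c3)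
  «one shape for μ»: at the same leaf twins, the Néron-normalised Mazur–Tate–Teitelbaum `p`-adic `L`-function
  `ϖ·L` (`L` in the `Ω⁺_f`-normalisation of the tree's `IsMultPAdicLFunctionOf f p a L`, `a = a_p = ±1`,
  `ϖ·Ω_E = Ω⁺_f`; `ϖ·L ∈ Λ` by Wuthrich 2014 Cor. 18) has a `p`-adic UNIT coefficient — rung K6's
  `AnalyticMuZeroX9` (item 19630) read at a multiplicative prime: class-wide it is Greenberg's Conj. 1.11 through
  the main conjecture, PER PAIR it is a finite exact modular-symbol computation; it implies TwinMu through a Kato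
  `μ`-transfer WITHOUT big image at `p ∥ N` (K6's `CoreTheoremAOddPrime` mechanism, whose good-ordinary binders
  are inert — `CoreAssembly.coreOdd_of_selmerDual_of_stepsTwoFour`), to be supplied by this seat as a sibling
  glue; until then TwinMu (literal) is the child of record.

The support bundle `KatoTwinFactsFive` (the twenty-two named facts the glue consumes, verbatim the fact binders of
p478491's refined-Kolyvagin theorem, overlapping the route's `PublishedInputsFive` 19066 by design as 19283 does) is
NOT declared here: like `PublishedInputsFive` ∕ `PublishedInputsIMCReduction` it is the route file's conjunction; the
glue takes it as ONE conjunction binder whose text the planner pastes as the support child's statement.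

HONEST FRAMING: four `Prop` constants (restrictions ∕ companions of an OPEN crux; NOTHING asserted); no named
fact minted here, no theorem, no `sorry`; the split is NOT
claimed lossless (the branches are sufficient, not necessary); BSD is not advanced; items 19065 ∕ 19064 stay open;
no census word, tier or label moves (T7). Flag `Cha05-Rmk25-structure` rides on the glue.

References: [McCallumLMS1991] §5 (p. 303), Cor. 5.6 (p. 310); [WZhang2014] Thm. 1.1, Rem. 5; [Jetchev2008]
Conj. 1.3; [GreenbergLNM1716] §1 Conj. 1.11 (p. 61), p. 121; [Wuthrich2014] Cor. 18, Prop. 21 (p. 398);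
[Kato2004Asterisque] Thm. 12.4–12.6, §17.13; [Cha2005] Thm. 21, Rmk. 25; [MatarNekovar2019] §0.9–0.11; tree:
`Theorems/ErratumRoadFiveNonSurjCornerTwinKatoFacts.lean` (p478491), `Theorems/ErratumRoadFiveRest3BranchesDefs.lean`.
-/

set_option autoImplicit false
set_option linter.dupNamespace false

noncomputable section

open scoped Classical NumberField MatrixGroups ModularForm

open CongruenceSubgroup WeierstrassCurve NumberField IsDedekindDomain Field
  Literature.NumberTheory.EllipticCurves
  Literature.NumberTheory.EllipticCurves.ModularForms
  Literature.NumberTheory.EllipticCurves.Rank1Residual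
  Literature.NumberTheory.QuadraticFields.Quadratic
  Summit.BirchSwinnertonDyer.Rank1Residual
  Summit.BirchSwinnertonDyer.Rank1Residual.X11b.Three.Koly

namespace Summit.BirchSwinnertonDyer.BirchSwinnertonDyer.Theorems

/-! ### §0 The three branches (route-posited objects; nothing asserted) -/

/-- [crux branch Zₚᶜ of item 19065 `NonSurjCorner`] **Refined-Kolyvagin CERTIFICATES on corner frames
(`M_∞ ≤ t`).** For every corner pair `(E,p)` (`ClassX11b`, `ρ̄_{E,p}` not onto, `p ∈ {5,7}`, `p ∣ ord_p Δ_min`,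
no (ram) witness) and every classical frame — `K` imaginary quadratic with `|d_K| > 4` satisfying the Heegner
hypothesis for `N` and for `p`, a modular parametrisation `Dt` of level `N = N_E` with `p ∤ deg`-constant `Dt.c`,
`β² ≡ d_K (mod 4N)`, `ι : K → ℂ` — some level `M ≤ t = ord_p ∏_ℓ c_ℓ(E/ℚ)` carries a certificate
`CertificateAt Dt β ι p M` (a square-free product `n` of Kolyvagin primes of index `≥ M+1` with `P_n ∉ p^{M+1}E(K[n])`).
W. Zhang 2014 Thm. 1.1 gives `M_∞ = 0` for `ρ̄` onto at good ordinary `p ∤ N` under ♠; nothing is in print at a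
non-surjective image or at `p ∥ N`. A `Prop` constant; OPEN; nothing asserted.
[cite: WZhang2014, Thm. 1.1 (p. 195) and Rem. 5 (p. 199) (shape only; nothing asserted)]
[cite: McCallumLMS1991, §5 (p. 303), Cor. 5.6 (p. 310) (definitions of M_r, M_∞)] -/
@[conjecture]
def NonSurjCornerKolyZ : Prop :=
  ∀ (W : WeierstrassCurve ℚ) [W.IsElliptic] [W.IsGloballyMinimal] (p : ℕ) [Fact p.Prime]
    (N : ℕ) [NeZero N] (K : Type) [Field K] [NumberField K]
    (Dt : ModularParametrizationData W N) (β : ℤ) (ι : K →+* ℂ),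
    ClassX11b W p → ¬ Surj W p → (p = 5 ∨ p = 7) → p ∣ padicValInt p W.minimalDiscriminantInt →
    ¬ Ram W p → W.conductorNorm ℤ = N → IsImaginaryQuadratic K →
    4 < (NumberField.discr K).natAbs → SatisfiesHeegnerHypothesis N K →
    SatisfiesHeegnerHypothesis p K → (4 * (N : ℤ)) ∣ β ^ 2 - NumberField.discr K → ¬ (p : ℤ) ∣ Dt.c →
    ∃ M : ℕ, M ≤ padicValNat p W.tamagawaProduct ∧ CertificateAt Dt β ι p M

/-- [crux branch Jₚᶜ of item 19065 `NonSurjCorner`] **The Jetchev direction on corner frames (`M_∞ ≥ t`).**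
For every corner pair and frame as in `NonSurjCornerKolyZ` (level `N = N_E`), every `s ≤ t = ord_p ∏_ℓ c_ℓ(E/ℚ)`
and every Kolyvagin–Heegner datum `d` of square-free conductor `n` all of whose prime factors are Kolyvagin primes of
index `≥ s`: the derived point is `p^s`-divisible, `PDiv d p s` (`P_n ∈ p^s E(K[n])`). Jetchev 2008 proves the
Tamagawa divisibility of the Kolyvagin classes at `p ∤ N`; nothing is in print at `p ∥ N`. A `Prop` constant; OPEN;
nothing asserted. [cite: Jetchev2008, Conj. 1.3 and Thm. 1.4 (shape only; nothing asserted)]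
[cite: McCallumLMS1991, §5 (p. 303) (P_n, p^M ∣ P_n)] -/
@[conjecture]
def NonSurjCornerKolyJ : Prop :=
  ∀ (W : WeierstrassCurve ℚ) [W.IsElliptic] [W.IsGloballyMinimal] [NeZero (W.conductorNorm ℤ)]
    (p : ℕ) [Fact p.Prime] (K : Type) [Field K] [NumberField K]
    (Dt : ModularParametrizationData W (W.conductorNorm ℤ)) (β : ℤ) (ι : K →+* ℂ),
    ClassX11b W p → ¬ Surj W p → (p = 5 ∨ p = 7) → p ∣ padicValInt p W.minimalDiscriminantInt →
    ¬ Ram W p → IsImaginaryQuadratic K → 4 < (NumberField.discr K).natAbs →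
    SatisfiesHeegnerHypothesis (W.conductorNorm ℤ) K → SatisfiesHeegnerHypothesis p K →
    (4 * (W.conductorNorm ℤ : ℤ)) ∣ β ^ 2 - NumberField.discr K → ¬ (p : ℤ) ∣ Dt.c →
    ∀ (s : ℕ), s ≤ padicValNat p W.tamagawaProduct →
      ∀ (n : ℕ) (d : KolyvaginHeegnerData Dt β ι n), Squarefree n →
        (∀ ℓ ∈ n.primeFactors, Zhang2014.IsKolyvaginPrime (W.conductorNorm ℤ) W K p ℓ ∧
          s ≤ Zhang2014.kolyvaginIndex W p ℓ) → PDiv d p s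

/-- [crux branch TwinMu of item 19065 `NonSurjCorner`] **Greenberg's `μ = 0` at the non-surjective X11a LEAF
TWINS (literal shape).** For every globally minimal `Wd` in class X11a (`r_an = 0`, `p ∥ N` odd, `E[p]`
irreducible, no (ram) witness) with `ρ̄_{Wd,p}` NOT onto, `p ∈ {5,7}` and `p ∣ ord_p Δ_min(Wd)`, every cyclotomic
`(κ, γ)` and every Selmer dual datum `D` of `Sel_{p^∞}(Wd/ℚ_∞)`: `μ(X) = 0`. This is Greenberg's Conj. 1.11 at an
irreducible NON-surjective image and a multiplicative prime (LNM 1716 p. 121: «it seems very difficult to verify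
this even for specific examples»); it is the one input of the twin's INTEGRAL Kato divisibility that print does
not supply at such an image (Wuthrich 2014 Prop. 21). Rung K6's transfer conclusion shape
(`Rank1Residual.KatoMuTransfer`, good ordinary) read at `p ∥ N`. A `Prop` constant; OPEN; nothing asserted.
[cite: GreenbergLNM1716, §1 Conj. 1.11 (p. 61) and p. 121 (shape only; nothing asserted)]
[cite: Wuthrich2014, Prop. 21 (p. 398) (the excluded image)] -/
@[conjecture]
def NonSurjCornerTwinMu : Prop :=
  ∀ (Wd : WeierstrassCurve ℚ) [Wd.IsElliptic] [Wd.IsGloballyMinimal] (p : ℕ) [Fact p.Prime],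
    ClassX11a Wd p → ¬ Surj Wd p → (p = 5 ∨ p = 7) → p ∣ padicValInt p Wd.minimalDiscriminantInt →
    ∀ (κ : ZpExtension ℚ p) (γ : Field.absoluteGaloisGroup ℚ),
      κ.IsCyclotomic → κ.IsTopGenerator γ → IsCyclotomicVariable p γ →
      ∀ D : Wd.SelmerDualData κ γ, D.mu = 0

/-- [crux branch TwinMuAn of item 19065 `NonSurjCorner` — the ANALYTIC form of TwinMu, rung K6's `AnalyticMuZeroX9`
shape at `p ∥ N`] **Analytic `μ = 0` at the non-surjective X11a leaf twins.** For every globally minimal `Wd` in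
class X11a with `ρ̄_{Wd,p}` NOT onto, `p ∈ {5,7}`, `p ∣ ord_p Δ_min(Wd)`, every newform `f` of `Wd`, the period
ratio `ϖ` (`ϖ·Ω_{Wd} = Ω⁺_f`) and every Mazur–Tate–Teitelbaum function `L` of `f` at `p` with allowable root
`a = a_p` (`a = 1` at a split, `a = −1` at a non-split multiplicative `p`; `IsMultPAdicLFunctionOf f p a L`, the
`Ω⁺_f`-normalisation): SOME coefficient of the Néron-normalised function `ϖ·L` (Wuthrich 2014 Cor. 18: `ϖ·L ∈ Λ`)
is a `p`-adic unit — `μ(ϖ·L) = 0`. Class-wide this is Greenberg's Conj. 1.11 read through the main conjecture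
(OPEN); PER PAIR it is a finite exact modular-symbol certificate (as K6's records for `AnalyticMuZeroX9`). A
`Prop` constant; OPEN; nothing asserted. [cite: GreenbergLNM1716, §1 Conj. 1.11 (p. 61) (shape only; nothing asserted)]
[cite: Wuthrich2014, Cor. 18 (p. 398) (L_p(E) ∈ Λ at a multiplicative odd prime)]
[cite: MazurTateTeitelbaum1986, §I.10 and §I.14 (allowable root a_p at p ∥ N)] -/
@[conjecture]
def NonSurjCornerTwinMuAn : Prop :=
  ∀ (Wd : WeierstrassCurve ℚ) [Wd.IsElliptic] [Wd.IsGloballyMinimal] (p : ℕ) [Fact p.Prime],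
    ClassX11a Wd p → ¬ Surj Wd p → (p = 5 ∨ p = 7) → p ∣ padicValInt p Wd.minimalDiscriminantInt →
    ∀ {N : ℕ} [NeZero N] (f : CuspForm (Gamma0 N) 2), IsNewformOf Wd f →
    ∀ (ϖ : ℚ), (ϖ : ℝ) * Wd.realPeriodRat = plusPeriod f →
    ∀ (a : ℚ_[p]) (L : PowerSeries ℚ_[p]),
      (Wd.HasSplitMultiplicativeReductionAtPrime p → a = 1) →
      (¬ Wd.HasSplitMultiplicativeReductionAtPrime p → a = -1) →
      IsMultPAdicLFunctionOf f p a L →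
      ∃ n : ℕ, ‖PowerSeries.coeff n (PowerSeries.C ((ϖ : ℚ) : ℚ_[p]) * L)‖ = 1

end Summit.BirchSwinnertonDyer.BirchSwinnertonDyer.Theorems

end
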